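import Mathlib.Analysis.SpecificLimits.Basic
import Mathlib.Algebra.Order.BigOperators.Group.Finset
import Mathlib.Algebra.BigOperators.Ring.Finset
import Mathlib.Algebra.BigOperators.Field
import HarnessLib

/-!
# `NoHeavyLowerTail` (stmt-CriticalPhenomena-4575) — positive association by an ALTERNATING TRANSFER OPERATOR
# (prim-hp-2 gen 47, THEOREM-IndepCopies.md §3; support file `--supports stmt-CriticalPhenomena-4575`)

The abstract engine of THEOREM IC (independent-copies version of CONJECTURE BIC).  `π : Ω → Ω → ℝ` is a symmetric
nonnegative pair weight (a reversible "pair chain"), `ν y = Σ_x π x y` its marginal, `T u y = (Σ_x π x y u x)/ν y`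
the transfer operator, `Up` a class of functions with (i) positively associated fibres
`(Σ_x π x y u x)(Σ_x π x y v x) ≤ ν y Σ_x π x y u x v x`, (ii) alternation `u ∈ Up ⇒ −T u ∈ Up`, (iii) a Doeblin
minorisation `ε λ x ν y ≤ π x y`.  Results: `Transfer.cov_nonneg` / `marginal_pa` (the marginal is positively
associated on `Up`), `Transfer.cross_le` (`u` and `T v` are negatively correlated), `Transfer.pair_form_nonneg`
(`0 ≤ Σ_{x,y} π x y (u x − u y)(v x − v y)`, "same ≥ cross").  Proof: total covariance
`Cov_ν(u,v) = Σ_y ν_y Cov_{π(·|y)}(u,v) + Cov_ν(Tu,Tv) ≥ Cov_ν(−Tu,−Tv)`, iterated, the tail killed by the Doeblin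
contraction `osc(Tu) ≤ (1−ε) osc(u)`.  Null states (`ν y = 0`) are allowed.  In the percolation instance (two
independent clusters coupled by bicluster avoidance) (i) and (ii) are van den Berg–Häggström–Kahn 2006, Thm 1.3.
No named facts, no sorries; file-local definitions `marg`, `mass`, `fib`, `transfer`, `strans`, `cov`, `Spread`, `Hyp`.
-/

noncomputable section

namespace Summit.CriticalPhenomena.PercolationContinuityZ3.Theorems
open scoped Classical
open Finset Filter Topology
namespace Antithetic
namespace Transfer

variable {Ω : Type*} [Fintype Ω]

/-- The marginal `ν y = Σ_x π x y` of a pair weight. [folklore] -/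
def marg (π : Ω → Ω → ℝ) (y : Ω) : ℝ := ∑ x, π x y

/-- The total mass `Σ_y ν y`. [folklore] -/
def mass (π : Ω → Ω → ℝ) : ℝ := ∑ y, marg π y

/-- The fibre sum `A_u(y) = Σ_x π x y · u x` (`= ν y · T u y`). [folklore] -/
def fib (π : Ω → Ω → ℝ) (u : Ω → ℝ) (y : Ω) : ℝ := ∑ x, π x y * u x

/-- The transfer operator `T u (y) = (Σ_x π x y · u x) / ν y` (conditional expectation of `u` on the fibre of `y`;
`0` on null states). [folklore] -/
def transfer (π : Ω → Ω → ℝ) (u : Ω → ℝ) (y : Ω) : ℝ := fib π u y / marg π y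

/-- The signed transfer `S u = −T u` (so that `S` maps the class `Up` to itself under the alternation
hypothesis). [folklore] -/
def strans (π : Ω → Ω → ℝ) (u : Ω → ℝ) (y : Ω) : ℝ := -transfer π u y

/-- The scaled covariance `cov u v = (Σν)·Σ ν u v − (Σ ν u)(Σ ν v)` (`= (Σν)² Cov_ν(u,v)`). [folklore] -/
def cov (π : Ω → Ω → ℝ) (u v : Ω → ℝ) : ℝ :=
  mass π * ∑ y, marg π y * (u y * v y) - (∑ y, marg π y * u y) * ∑ y, marg π y * v y

/-- `Spread π u d`: the oscillation of `u` over the support of `ν` is at most `d`. [folklore] -/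
def Spread (π : Ω → Ω → ℝ) (u : Ω → ℝ) (d : ℝ) : Prop :=
  ∀ x x', marg π x ≠ 0 → marg π x' ≠ 0 → u x - u x' ≤ d

/-- The hypotheses of the alternating-transfer lemma: a symmetric nonnegative pair weight with positively
associated fibres on the class `Up`, a transfer operator that maps `Up` to `−Up`, and a Doeblin minorisation.
[folklore] -/
structure Hyp (π : Ω → Ω → ℝ) (Up : (Ω → ℝ) → Prop) : Prop where
  symm : ∀ x y, π x y = π y x
  nonneg : ∀ x y, 0 ≤ π x y
  fibre : ∀ y u v, Up u → Up v → fib π u y * fib π v y ≤ marg π y * fib π (fun x => u x * v x) y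
  alt : ∀ u, Up u → Up (strans π u)
  doeblin : ∃ ε : ℝ, 0 < ε ∧ ∃ lam : Ω → ℝ, (∀ x, 0 ≤ lam x) ∧ ∑ x, lam x = 1 ∧
    ∀ x y, ε * lam x * marg π y ≤ π x y

section Basic
variable {π : Ω → Ω → ℝ}

/-- Marginals of a nonnegative pair weight are nonnegative. [folklore] -/
theorem marg_nonneg (hπ : ∀ x y, 0 ≤ π x y) (y : Ω) : 0 ≤ marg π y :=
  Finset.sum_nonneg fun x _ => hπ x y

/-- The total mass of a nonnegative pair weight is nonnegative. [folklore] -/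
theorem mass_nonneg (hπ : ∀ x y, 0 ≤ π x y) : 0 ≤ mass π :=
  Finset.sum_nonneg fun y _ => marg_nonneg hπ y

/-- On a null state every pair weight vanishes. [folklore] -/
theorem eq_zero_of_marg_eq_zero (hπ : ∀ x y, 0 ≤ π x y) {y : Ω} (hy : marg π y = 0) (x : Ω) :
    π x y = 0 := by
  have h := (Finset.sum_eq_zero_iff_of_nonneg (fun x _ => hπ x y)).1 hy
  exact h x (Finset.mem_univ x)

/-- Fibre sums over a null state vanish. [folklore] -/
theorem fib_eq_zero_of_marg_eq_zero (hπ : ∀ x y, 0 ≤ π x y) {y : Ω} (hy : marg π y = 0) (u : Ω → ℝ) :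
    fib π u y = 0 :=
  Finset.sum_eq_zero fun x _ => by rw [eq_zero_of_marg_eq_zero hπ hy x, zero_mul]

/-- `ν y · T u y = A_u(y)` (also on null states, where both sides vanish). [folklore] -/
theorem marg_mul_transfer (hπ : ∀ x y, 0 ≤ π x y) (u : Ω → ℝ) (y : Ω) :
    marg π y * transfer π u y = fib π u y := by
  unfold transfer; by_cases hy : marg π y = 0
  · rw [hy, zero_mul, fib_eq_zero_of_marg_eq_zero hπ hy]
  · rw [mul_div_cancel₀ _ hy]

/-- Stationarity: `Σ_y A_u(y) = Σ_x ν x · u x`. [folklore] -/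
theorem sum_fib (hs : ∀ x y, π x y = π y x) (u : Ω → ℝ) : ∑ y, fib π u y = ∑ x, marg π x * u x := by
  unfold fib marg; rw [Finset.sum_comm]; refine Finset.sum_congr rfl fun x _ => ?_
  rw [Finset.sum_mul]; exact Finset.sum_congr rfl fun y _ => by rw [hs x y]

/-- Stationarity of the transfer: `Σ ν · T u = Σ ν · u`. [folklore] -/
theorem sum_marg_mul_transfer (hs : ∀ x y, π x y = π y x) (hπ : ∀ x y, 0 ≤ π x y) (u : Ω → ℝ) :
    ∑ y, marg π y * transfer π u y = ∑ x, marg π x * u x := by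
  simp_rw [marg_mul_transfer hπ]; exact sum_fib hs u

/-- The covariance as a double sum: `cov u v = ½ Σ_y Σ_y' ν y ν y' (u y − u y')(v y − v y')`. [folklore] -/
theorem two_mul_cov (u v : Ω → ℝ) :
    2 * cov π u v = ∑ y, ∑ y', marg π y * marg π y' * ((u y - u y') * (v y - v y')) := by
  have e : ∀ y y', marg π y * marg π y' * ((u y - u y') * (v y - v y')) =
      marg π y' * (marg π y * (u y * v y)) + marg π y * (marg π y' * (u y' * v y')) -
        (marg π y * u y) * (marg π y' * v y') - (marg π y' * u y') * (marg π y * v y) := fun y y' => by ring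
  simp_rw [e, Finset.sum_sub_distrib, Finset.sum_add_distrib]
  have hA : ∑ y, ∑ y', marg π y' * (marg π y * (u y * v y)) = mass π * ∑ y, marg π y * (u y * v y) := by
    unfold mass; rw [Finset.mul_sum]
    exact Finset.sum_congr rfl fun y _ => by rw [← Finset.sum_mul]
  have hB : ∑ y, ∑ y', marg π y * (marg π y' * (u y' * v y')) = mass π * ∑ y, marg π y * (u y * v y) := by
    unfold mass; rw [Finset.sum_mul]
    exact Finset.sum_congr rfl fun y _ => by rw [← Finset.mul_sum]
  have hC : ∑ y, ∑ y', marg π y * u y * (marg π y' * v y') =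
      (∑ y, marg π y * u y) * ∑ y, marg π y * v y := by
    rw [Finset.sum_mul]; exact Finset.sum_congr rfl fun y _ => by rw [← Finset.mul_sum]
  have hD : ∑ y, ∑ y', marg π y' * u y' * (marg π y * v y) =
      (∑ y, marg π y * u y) * ∑ y, marg π y * v y := by
    rw [Finset.sum_comm, Finset.sum_mul]; exact Finset.sum_congr rfl fun y' _ => by rw [← Finset.mul_sum]
  rw [hA, hB, hC, hD]; unfold cov; ring

/-- The transfer written against the Doeblin residual weights:
`T u y = Σ_x (π x y / ν y − ε λ x) u x + ε Σ_x λ x u x`. [folklore] -/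
theorem transfer_eq_residual (ε : ℝ) (lam : Ω → ℝ) (u : Ω → ℝ) (y : Ω) :
    transfer π u y = ∑ x, (π x y / marg π y - ε * lam x) * u x + ε * ∑ x, lam x * u x := by
  unfold transfer fib
  rw [Finset.sum_div, Finset.mul_sum, ← Finset.sum_add_distrib]
  exact Finset.sum_congr rfl fun x _ => by ring

end Basic

section Main
variable {π : Ω → Ω → ℝ} {Up : (Ω → ℝ) → Prop}

/-- **Total covariance, one step**: `cov(Tu,Tv) ≤ cov(u,v)` for `u, v ∈ Up` (the fibre covariances are
nonnegative). [folklore] -/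
theorem cov_transfer_le (H : Hyp π Up) {u v : Ω → ℝ} (hu : Up u) (hv : Up v) :
    cov π (transfer π u) (transfer π v) ≤ cov π u v := by
  have hπ := H.nonneg
  -- Σ ν (Tu)(Tv) ≤ Σ_y A_{uv}(y) = Σ ν u v
  have h1 : ∀ y, marg π y * (transfer π u y * transfer π v y) ≤ fib π (fun x => u x * v x) y := by
    intro y; by_cases hy : marg π y = 0
    · rw [hy, zero_mul, fib_eq_zero_of_marg_eq_zero hπ hy]
    · have hpos : 0 < marg π y := lt_of_le_of_ne (marg_nonneg hπ y) (Ne.symm hy)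
      have key := H.fibre y u v hu hv
      rw [← marg_mul_transfer hπ u y, ← marg_mul_transfer hπ v y] at key
      have : marg π y * (marg π y * (transfer π u y * transfer π v y)) ≤
          marg π y * fib π (fun x => u x * v x) y := by nlinarith
      exact le_of_mul_le_mul_left this hpos
  have h2 : ∑ y, marg π y * (transfer π u y * transfer π v y) ≤ ∑ y, marg π y * (u y * v y) := by
    calc ∑ y, marg π y * (transfer π u y * transfer π v y) ≤ ∑ y, fib π (fun x => u x * v x) y :=
          Finset.sum_le_sum fun y _ => h1 y
      _ = ∑ y, marg π y * (u y * v y) := sum_fib H.symm _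
  unfold cov; rw [sum_marg_mul_transfer H.symm hπ u, sum_marg_mul_transfer H.symm hπ v]
  have hm := mass_nonneg hπ (π := π); nlinarith

/-- The signed transfer has the same covariances as the transfer. [folklore] -/
theorem cov_strans (u v : Ω → ℝ) : cov π (strans π u) (strans π v) = cov π (transfer π u) (transfer π v) := by
  unfold cov strans
  have e1 : ∀ w : Ω → ℝ, ∑ y, marg π y * -w y = -∑ y, marg π y * w y := fun w => by
    rw [← Finset.sum_neg_distrib]; exact Finset.sum_congr rfl fun y _ => by ring
  simp_rw [neg_mul_neg, e1]; ring

/-- Iteration: `cov(S^k u, S^k v) ≤ cov(u,v)` for `u, v ∈ Up`. [folklore] -/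
theorem cov_iterate_le (H : Hyp π Up) (k : ℕ) :
    ∀ {u v : Ω → ℝ}, Up u → Up v → cov π ((strans π)^[k] u) ((strans π)^[k] v) ≤ cov π u v := by
  induction k with
  | zero => intro u v _ _; simp
  | succ k ih =>
    intro u v hu hv; rw [Function.iterate_succ_apply, Function.iterate_succ_apply]
    calc cov π ((strans π)^[k] (strans π u)) ((strans π)^[k] (strans π v))
        ≤ cov π (strans π u) (strans π v) := ih (H.alt u hu) (H.alt v hv)
      _ = cov π (transfer π u) (transfer π v) := cov_strans u v
      _ ≤ cov π u v := cov_transfer_le H hu hv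

/-- **Doeblin contraction**: if `u` oscillates by at most `d` on the support, then `T u` oscillates by at most
`(1 − ε) d`. [folklore] -/
theorem spread_transfer (H : Hyp π Up) {ε : ℝ} (hε : 0 ≤ ε) {lam : Ω → ℝ} (hlam0 : ∀ x, 0 ≤ lam x)
    (hlam1 : ∑ x, lam x = 1) (hdob : ∀ x y, ε * lam x * marg π y ≤ π x y) {u : Ω → ℝ} {d : ℝ}
    (hsp : Spread π u d) : Spread π (transfer π u) ((1 - ε) * d) := by
  have hπ := H.nonneg
  intro y y' hy hy'
  have hpos : 0 < marg π y := lt_of_le_of_ne (marg_nonneg hπ y) (Ne.symm hy)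
  have hpos' : 0 < marg π y' := lt_of_le_of_ne (marg_nonneg hπ y') (Ne.symm hy')
  -- residual weights a_x = π x y / ν y − ε lam x ≥ 0 (and b for y'), each family summing to 1 − ε
  have ha0 : ∀ x, 0 ≤ π x y / marg π y - ε * lam x := fun x => by
    rw [sub_nonneg, le_div_iff₀ hpos]; exact hdob x y
  have hb0 : ∀ x, 0 ≤ π x y' / marg π y' - ε * lam x := fun x => by
    rw [sub_nonneg, le_div_iff₀ hpos']; exact hdob x y'
  have hsuma : ∑ x, (π x y / marg π y - ε * lam x) = 1 - ε := by
    rw [Finset.sum_sub_distrib, ← Finset.sum_div, ← Finset.mul_sum, hlam1, mul_one]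
    unfold marg; rw [div_self (by simpa [marg] using hy)]
  have hsumb : ∑ x, (π x y' / marg π y' - ε * lam x) = 1 - ε := by
    rw [Finset.sum_sub_distrib, ← Finset.sum_div, ← Finset.mul_sum, hlam1, mul_one]
    unfold marg; rw [div_self (by simpa [marg] using hy')]
  -- off the support the residual weights vanish
  have hax : ∀ x, marg π x = 0 →
      π x y / marg π y - ε * lam x = 0 ∧ π x y' / marg π y' - ε * lam x = 0 := by
    intro x hx
    have h1 : π x y = 0 := by rw [H.symm]; exact eq_zero_of_marg_eq_zero hπ hx y
    have h2 : π x y' = 0 := by rw [H.symm]; exact eq_zero_of_marg_eq_zero hπ hx y'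
    have h4 := ha0 x; rw [h1, zero_div, zero_sub, neg_nonneg] at h4
    have h5 : ε * lam x = 0 := le_antisymm h4 (mul_nonneg hε (hlam0 x))
    exact ⟨by rw [h1, zero_div, zero_sub, h5, neg_zero], by rw [h2, zero_div, zero_sub, h5, neg_zero]⟩
  -- a maximiser and a minimiser of u on the support
  obtain ⟨xM, hxM, hM⟩ := Finset.exists_max_image (Finset.univ.filter fun x => marg π x ≠ 0) u
    ⟨y, by simp [hy]⟩
  obtain ⟨xm, hxm, hm⟩ := Finset.exists_min_image (Finset.univ.filter fun x => marg π x ≠ 0) u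
    ⟨y, by simp [hy]⟩
  simp only [Finset.mem_filter, Finset.mem_univ, true_and] at hxM hxm hM hm
  have hup : ∑ x, (π x y / marg π y - ε * lam x) * u x ≤ (1 - ε) * u xM := by
    calc ∑ x, (π x y / marg π y - ε * lam x) * u x
        ≤ ∑ x, (π x y / marg π y - ε * lam x) * u xM := Finset.sum_le_sum fun x _ => by
            by_cases hx : marg π x = 0
            · rw [(hax x hx).1]; simp
            · exact mul_le_mul_of_nonneg_left (hM x hx) (ha0 x)
      _ = (1 - ε) * u xM := by rw [← Finset.sum_mul, hsuma]
  have hlow : (1 - ε) * u xm ≤ ∑ x, (π x y' / marg π y' - ε * lam x) * u x := by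
    calc (1 - ε) * u xm = ∑ x, (π x y' / marg π y' - ε * lam x) * u xm := by
            rw [← Finset.sum_mul, hsumb]
      _ ≤ ∑ x, (π x y' / marg π y' - ε * lam x) * u x := Finset.sum_le_sum fun x _ => by
            by_cases hx : marg π x = 0
            · rw [(hax x hx).2]; simp
            · exact mul_le_mul_of_nonneg_left (hm x hx) (hb0 x)
  have hε1 : 0 ≤ 1 - ε := by rw [← hsuma]; exact Finset.sum_nonneg fun x _ => ha0 x
  have hMm : u xM - u xm ≤ d := hsp xM xm hxM hxm
  rw [transfer_eq_residual ε lam u y, transfer_eq_residual ε lam u y']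
  nlinarith

/-- Oscillation is invariant under the sign flip `T ↦ −T`. [folklore] -/
theorem spread_strans {u : Ω → ℝ} {d : ℝ} (hsp : Spread π (transfer π u) d) : Spread π (strans π u) d := by
  intro x x' hx hx'; have := hsp x' x hx' hx; unfold strans; linarith

/-- Iterated Doeblin contraction: `osc(S^k u) ≤ (1 − ε)^k osc(u)`. [folklore] -/
theorem spread_iterate (H : Hyp π Up) {ε : ℝ} (hε : 0 ≤ ε) {lam : Ω → ℝ} (hlam0 : ∀ x, 0 ≤ lam x)
    (hlam1 : ∑ x, lam x = 1) (hdob : ∀ x y, ε * lam x * marg π y ≤ π x y) :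
    ∀ (k : ℕ) {d : ℝ} {u : Ω → ℝ}, Spread π u d → Spread π ((strans π)^[k] u) ((1 - ε) ^ k * d) := by
  intro k
  induction k with
  | zero => intro d u hu; simpa using hu
  | succ k ih =>
    intro d u hu; rw [Function.iterate_succ_apply]
    have h2 := ih (spread_strans (spread_transfer H hε hlam0 hlam1 hdob hu))
    have : (1 - ε) ^ k * ((1 - ε) * d) = (1 - ε) ^ (k + 1) * d := by ring
    rw [this] at h2; exact h2

/-- Covariance is small for functions of small oscillation: `2 cov(u,v) ≥ −(Σν)² d_u d_v`. [folklore] -/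
theorem cov_ge_of_spread (hπ : ∀ x y, 0 ≤ π x y) {u v : Ω → ℝ} {du dv : ℝ}
    (hu : Spread π u du) (hv : Spread π v dv) :
    -(mass π ^ 2 * (du * dv)) ≤ 2 * cov π u v := by
  rw [two_mul_cov]
  have hterm : ∀ y y', -(marg π y * marg π y' * (du * dv)) ≤
      marg π y * marg π y' * ((u y - u y') * (v y - v y')) := by
    intro y y'
    by_cases hy : marg π y = 0
    · simp [hy]
    by_cases hy' : marg π y' = 0
    · simp [hy']
    have hprod : -(du * dv) ≤ (u y - u y') * (v y - v y') := by
      have ha : |u y - u y'| ≤ du := abs_le.2 ⟨by linarith [hu y' y hy' hy], hu y y' hy hy'⟩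
      have hb : |v y - v y'| ≤ dv := abs_le.2 ⟨by linarith [hv y' y hy' hy], hv y y' hy hy'⟩
      have hab : |(u y - u y') * (v y - v y')| ≤ du * dv := by
        rw [abs_mul]; exact mul_le_mul ha hb (abs_nonneg _) (le_trans (abs_nonneg _) ha)
      exact (abs_le.1 hab).1
    have hw : 0 ≤ marg π y * marg π y' := mul_nonneg (marg_nonneg hπ y) (marg_nonneg hπ y')
    nlinarith
  have : ∑ y, ∑ y', -(marg π y * marg π y' * (du * dv)) = -(mass π ^ 2 * (du * dv)) := by
    simp only [Finset.sum_neg_distrib]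
    unfold mass; rw [sq, Finset.sum_mul_sum, Finset.sum_mul]; congr 1
    exact Finset.sum_congr rfl fun y _ => by rw [Finset.sum_mul]
  rw [← this]; exact Finset.sum_le_sum fun y _ => Finset.sum_le_sum fun y' _ => hterm y y'

/-- Every function has finite oscillation `2 Σ |u|` on a finite type. [folklore] -/
theorem spread_of_fintype (u : Ω → ℝ) : Spread π u (2 * ∑ x, |u x|) := by
  intro x x' _ _
  have h1 : |u x| ≤ ∑ z, |u z| := Finset.single_le_sum (fun z _ => abs_nonneg (u z)) (Finset.mem_univ x)
  have h2 : |u x'| ≤ ∑ z, |u z| := Finset.single_le_sum (fun z _ => abs_nonneg (u z)) (Finset.mem_univ x')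
  linarith [le_abs_self (u x), neg_abs_le (u x')]

/-- **Positive association of the marginal** (THEOREM IC (a), abstract form): for `u, v ∈ Up`,
`(Σ ν u)(Σ ν v) ≤ (Σ ν)·Σ ν u v`. [folklore] -/
theorem cov_nonneg (H : Hyp π Up) {u v : Ω → ℝ} (hu : Up u) (hv : Up v) : 0 ≤ cov π u v := by
  have hπ := H.nonneg
  obtain ⟨ε, hε, lam, hlam0, hlam1, hdob⟩ := H.doeblin
  set du := 2 * ∑ x, |u x| with hdu
  set dv := 2 * ∑ x, |v x| with hdv
  have hdu0 : 0 ≤ du := by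
    rw [hdu]; exact mul_nonneg zero_le_two (Finset.sum_nonneg fun x _ => abs_nonneg _)
  have hdv0 : 0 ≤ dv := by
    rw [hdv]; exact mul_nonneg zero_le_two (Finset.sum_nonneg fun x _ => abs_nonneg _)
  have hsu : Spread π u du := spread_of_fintype u
  have hsv : Spread π v dv := spread_of_fintype v
  -- ε ≤ 1 unless the support is empty (then cov = 0)
  by_cases hm : mass π = 0
  · -- all marginals vanish
    have hall : ∀ y, marg π y = 0 := fun y =>
      (Finset.sum_eq_zero_iff_of_nonneg (fun y _ => marg_nonneg hπ y)).1 hm y (Finset.mem_univ y)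
    unfold cov mass; simp [hall]
  have hmpos : 0 < mass π := lt_of_le_of_ne (mass_nonneg hπ) (Ne.symm hm)
  obtain ⟨y0, -, hy0⟩ : ∃ y ∈ (Finset.univ : Finset Ω), marg π y ≠ 0 :=
    Finset.exists_ne_zero_of_sum_ne_zero hm
  have hε1 : 0 ≤ 1 - ε := by
    have hpos : 0 < marg π y0 := lt_of_le_of_ne (marg_nonneg hπ y0) (Ne.symm hy0)
    have h1 : ∑ x, ε * lam x * marg π y0 ≤ ∑ x, π x y0 := Finset.sum_le_sum fun x _ => hdob x y0
    rw [← Finset.sum_mul, ← Finset.mul_sum, hlam1, mul_one] at h1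
    have : ε * marg π y0 ≤ 1 * marg π y0 := by simpa [marg] using h1
    linarith [le_of_mul_le_mul_right this hpos]
  have hr1 : (1 - ε) ^ 2 < 1 := by nlinarith
  have hr0 : 0 ≤ (1 - ε) ^ 2 := sq_nonneg _
  -- for every k: 2 cov(u,v) ≥ 2 cov(S^k u, S^k v) ≥ −mass² ((1−ε)²)^k du dv
  have hk : ∀ k : ℕ, -(mass π ^ 2 * (du * dv)) * ((1 - ε) ^ 2) ^ k ≤ 2 * cov π u v := by
    intro k
    have h1 := cov_iterate_le H k hu hv
    have h2 := cov_ge_of_spread hπ (spread_iterate H hε.le hlam0 hlam1 hdob k hsu)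
      (spread_iterate H hε.le hlam0 hlam1 hdob k hsv)
    have hp : (1 - ε) ^ k * (1 - ε) ^ k = ((1 - ε) ^ 2) ^ k := by rw [sq, mul_pow]
    have e : mass π ^ 2 * ((1 - ε) ^ k * du * ((1 - ε) ^ k * dv)) =
        mass π ^ 2 * (du * dv) * ((1 - ε) ^ 2) ^ k := by rw [← hp]; ring
    linarith
  have hlim : Tendsto (fun k : ℕ => -(mass π ^ 2 * (du * dv)) * ((1 - ε) ^ 2) ^ k) atTop (𝓝 0) := by
    have := (tendsto_pow_atTop_nhds_zero_of_lt_one hr0 hr1).const_mul (-(mass π ^ 2 * (du * dv)))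
    simpa using this
  have : (0 : ℝ) ≤ 2 * cov π u v := le_of_tendsto' hlim hk
  linarith

/-- **PA of the marginal, product form**: `(Σ ν u)(Σ ν v) ≤ (Σν) Σ ν·(u v)` for `u, v ∈ Up`. [folklore] -/
theorem marginal_pa (H : Hyp π Up) {u v : Ω → ℝ} (hu : Up u) (hv : Up v) :
    (∑ y, marg π y * u y) * (∑ y, marg π y * v y) ≤ mass π * ∑ y, marg π y * (u y * v y) := by
  have := cov_nonneg H hu hv; unfold cov at this; linarith

/-- **Negative correlation across the pair** (THEOREM IC (b), abstract form): for `u, v ∈ Up`,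
`(Σν)·Σ_{x,y} π x y · u y · v x ≤ (Σ ν u)(Σ ν v)`. [folklore] -/
theorem cross_le (H : Hyp π Up) {u v : Ω → ℝ} (hu : Up u) (hv : Up v) :
    mass π * ∑ y, u y * fib π v y ≤ (∑ y, marg π y * u y) * ∑ y, marg π y * v y := by
  have h := cov_nonneg H hu (H.alt v hv)
  unfold cov strans at h
  have e1 : ∑ y, marg π y * -transfer π v y = -∑ y, marg π y * v y := by
    rw [← sum_marg_mul_transfer H.symm H.nonneg v, ← Finset.sum_neg_distrib]
    exact Finset.sum_congr rfl fun y _ => by ring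
  have e2 : ∑ y, marg π y * (u y * -transfer π v y) = -∑ y, u y * fib π v y := by
    rw [← Finset.sum_neg_distrib]
    refine Finset.sum_congr rfl fun y _ => ?_
    rw [← marg_mul_transfer H.nonneg v y]; ring
  rw [e1, e2] at h; linarith

/-- **Same ≥ cross** (THEOREM IC, abstract form): for `u, v ∈ Up`,
`0 ≤ Σ_x Σ_y π x y (u x − u y)(v x − v y)`. [folklore] -/
theorem pair_form_nonneg (H : Hyp π Up) {u v : Ω → ℝ} (hu : Up u) (hv : Up v) :
    0 ≤ ∑ x, ∑ y, π x y * ((u x - u y) * (v x - v y)) := by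
  have hπ := H.nonneg
  have hA := cov_nonneg H hu hv
  have hB := cross_le H hu hv
  -- Σ_{x,y} π (u x − u y)(v x − v y) = 2 Σ ν u v − 2 Σ_y u y A_v(y)
  have key : ∑ x, ∑ y, π x y * ((u x - u y) * (v x - v y)) =
      2 * ∑ y, marg π y * (u y * v y) - 2 * ∑ y, u y * fib π v y := by
    have e : ∀ x y, π x y * ((u x - u y) * (v x - v y)) =
        π x y * (u x * v x) + π x y * (u y * v y) - π x y * (u x * v y) - π x y * (u y * v x) :=
      fun x y => by ring
    simp_rw [e, Finset.sum_sub_distrib, Finset.sum_add_distrib]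
    have s1 : ∑ x, ∑ y, π x y * (u x * v x) = ∑ y, marg π y * (u y * v y) := by
      refine Finset.sum_congr rfl fun x _ => ?_
      rw [← Finset.sum_mul]; unfold marg
      rw [Finset.sum_congr rfl fun y _ => H.symm x y]
    have s2 : ∑ x, ∑ y, π x y * (u y * v y) = ∑ y, marg π y * (u y * v y) := by
      rw [Finset.sum_comm]; refine Finset.sum_congr rfl fun y _ => ?_; rw [← Finset.sum_mul]; rfl
    have s3 : ∑ x, ∑ y, π x y * (u x * v y) = ∑ y, u y * fib π v y := by
      refine Finset.sum_congr rfl fun x _ => ?_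
      unfold fib; rw [Finset.mul_sum]
      exact Finset.sum_congr rfl fun y _ => by rw [H.symm x y]; ring
    have s4 : ∑ x, ∑ y, π x y * (u y * v x) = ∑ y, u y * fib π v y := by
      rw [Finset.sum_comm]; refine Finset.sum_congr rfl fun y _ => ?_
      unfold fib; rw [Finset.mul_sum]; exact Finset.sum_congr rfl fun x _ => by ring
    rw [s1, s2, s3, s4]; ring
  rw [key]
  by_cases hm : mass π = 0
  · have hall : ∀ y, marg π y = 0 := fun y =>
      (Finset.sum_eq_zero_iff_of_nonneg (fun y _ => marg_nonneg hπ y)).1 hm y (Finset.mem_univ y)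
    have hf : ∀ y, fib π v y = 0 := fun y => fib_eq_zero_of_marg_eq_zero hπ (hall y) v
    simp [hall, hf]
  have hmpos : 0 < mass π := lt_of_le_of_ne (mass_nonneg hπ) (Ne.symm hm)
  -- mass · (Σνuv − Σ u A_v) = cov u v + (ΣνuΣνv − mass Σ u A_v) ≥ 0
  have : 0 ≤ mass π * (∑ y, marg π y * (u y * v y) - ∑ y, u y * fib π v y) := by
    unfold cov at hA; nlinarith
  have := (mul_nonneg_iff_of_pos_left hmpos).1 this
  linarith

end Main
end Transfer
end Antithetic
end Summit.CriticalPhenomena.PercolationContinuityZ3.Theorems
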